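import Literature.MathematicalPhysics.QuantumFieldTheory.Balaban1983to89.T4TriangularPushforward
import HarnessLib

/-!
# `AlphaInputsT3ACWeightedInverseChart` — the weighted inverse chart of an injective measurable map, and the PRIVATE-COORDINATE
# weighted fibre chart of a local block averaging (brick (B2-F2a) of `pub/ym-inputs/I10-B2-FIBRE-LOCATE-p08.md`; cell ym3-torus, desk
# pub/ym-inputs INPUT-LIST v7 §3 I-10 ∕ I-12; seat ym-inputs-p08 g3; helper `--supports stmt-QuantumFields-20520`)

WHY.  The socket `…AlphaInputsT3ACWeightedFibreFormula.rnTransport_ae_eq_weightedFibreIntegral_local` turns ONE measure identity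
`hmap : (((dV ⊗ κ)↾S).withDensity J).map Φ = dU↾O` (a chart `Φ` of part of the fibres of an averaging `Ū`, with a weight `J`) into the
fibre formula `(Tρ)(V) = ∫ 𝟙_S J ρ∘Φ dκ` for the Radon–Nikodym transport of every density supported in `O`; the two trivial-history rows of
`…AlphaInputsT3ACv3StepTrivPinsChart` consume exactly that.  For the lane's axial averaging the chart is the axial gauge; for the T³ record's
`blockAvg ℰp` ([Balaban1987RG1] (0.4) with the printed `exp[mean log]`) print uses the linearised constraint (17) of [Balaban1985UV3] with the
Jacobian (18).  THIS FILE builds `hmap` by a THIRD route that needs no gauge fixing and no formula for the Jacobian — the PRIVATE COORDINATES of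
`BlockAveragingHaarAC` ∕ `T4TriangularPushforward`: an injection `β : κ → ι` of output (coarse) into input (fine) coordinates with
`IsLocal β A` (the output at `c′ ≠ c` does not see the input at `β c`).  Resampling the private coordinates, `res (U′, g) := Function.extend β g U′`
(measure preserving, `measurePreserving_resample`), makes the averaging DIAGONAL given the environment `U′`:
`A (res (U′, g)) c = A (update U′ (β c) (g c)) c` (`apply_resample_eq`).  Hence:
* §1 (W) `exists_weightedInverseChart` — GENERIC: an injective-on-`O` measurable map `T : X → Y` between standard Borel spaces whose restricted
  push-forward is absolutely continuous, `(m↾O).map T ≪ M`, has a measurable inverse `Ψ` and a measurable weight `J ≥ 0` with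
  `((M↾T''O).withDensity J).map Ψ = m↾O` and `Ψ (T x) = x` on `O` (Lusin–Souslin `Measurable.measurableEmbedding` +
  `MeasurableEmbedding.exists_measurable_extend`; `J` = the Radon–Nikodym derivative `d((m↾O).map T)/dM`, `Measure.withDensity_rnDeriv_eq`);
* §2 (A″) `map_prod_pi_absolutelyContinuous_env` — the law of `(U′, (c ↦ f c U′ (g c)))` under `ν ⊗ μ^κ` is absolutely continuous with respect
  to `ν ⊗ μ^κ` as soon as every one-variable law `μ.map (f c U′)` is (twin of `T4TriangularPushforward.map_prod_pi_absolutelyContinuous`, which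
  forgets the environment);
* §3 (A) `exists_weightedChart_of_isLocal` — for `IsLocal β A`, `β` injective, `A` measurable, every one-variable law
  `μ.map (x ↦ A (update U (β c) x) c)` absolutely continuous, and a measurable region `O` of fine fields on which «`A ∘ res` is injective in the
  private coordinates» (`res (U′,g), res (U′,g′) ∈ O`, `A (res (U′,g)) = A (res (U′,g′)) ⇒ g = g′` — in the application: one-variable
  injectivity of each `x ↦ A (update U′ (β c) x) c` on a guard), THERE ARE measurable `Φ : (κ → G) × (ι → G) → (ι → G)`, `J ≥ 0` and `S` with
  `A (Φ z) = z.1`, `Φ z ∈ O` on `S` and `((((μ^κ) ⊗ (μ^ι))↾S).withDensity J).map Φ = (μ^ι)↾O` — the socket's `hmap`∕`hfib` with parameter space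
  `R :=` the fine fields themselves (the environment) and `κ := μ^ι`.
The instance for `blockAvg expMeanLogSU` (`β = centralBond`, `isLocal_avgFun`, one-variable laws by `BlockAveragingEMLHaarACSUN` ∕
`…EMLFibreLawSUN`, one-variable injectivity on a small guard) is the sibling file `…BlockAvgEMLWeightedFibreChart` — NOT here.

HONEST SCOPE.  [folklore] measure theory (Lusin–Souslin, Radon–Nikodym, Fubini on null sets); nothing of [Balaban1985UV3] ∕ [Balaban1987RG1] is
asserted; count-neutral; no summit ∕ sub-problem statement proved (rung R3 bookkeeping; not T⁴, not Clay; the Yang–Mills mass gap is NOT proved).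
Def-free; L-floor: none.  References: T. Bałaban, CMP 102 (1985) 255–275 [Balaban1985UV3] ((13)–(18) pp.259–260); CMP 109 (1987) 249–301
[Balaban1987RG1] ((0.4) p.253); CMP 98 (1985) 17–51 [Balaban1985Averaging] ((10) p.19).
-/

set_option autoImplicit false

noncomputable section

namespace Summit.QuantumFields.YangMills.Theorems.WeightedInverseChart

open MeasureTheory Set Function
open scoped ENNReal NNReal
open Literature.MathematicalPhysics.QuantumFieldTheory.Balaban1983to89.T4TriangularPushforward

/-! ## §1 (W) The weighted inverse chart of an injective measurable map with absolutely continuous push-forward -/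

section InverseChart

variable {X Y : Type*} [MeasurableSpace X] [StandardBorelSpace X] [Nonempty X] [MeasurableSpace Y] [StandardBorelSpace Y]

omit [StandardBorelSpace X] [Nonempty X] [StandardBorelSpace Y] in
/-- The push-forward of `m↾O` under `T` gives full measure to the image `T '' O` (when that image is measurable). [folklore] -/
theorem ae_mem_image_map_restrict (m : Measure X) {T : X → Y} (hT : Measurable T) (O : Set X)
    (hS : MeasurableSet (T '' O)) : ∀ᵐ y ∂((m.restrict O).map T), y ∈ T '' O := by
  rw [ae_iff]
  show ((m.restrict O).map T) (T '' O)ᶜ = 0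
  rw [Measure.map_apply hT hS.compl, Measure.restrict_apply (hT hS.compl)]
  refine measure_mono_null (fun x hx => ?_) (measure_empty (μ := m))
  exact hx.1 (mem_image_of_mem T hx.2)

/-- **(W) THE WEIGHTED INVERSE CHART.**  Let `X`, `Y` be standard Borel, `m` a finite measure on `X`, `M` a σ-finite measure on `Y`, `T : X → Y`
measurable and injective on a measurable set `O`, with `(m↾O).map T ≪ M`.  Then there are a measurable `Ψ : Y → X` and a measurable weight
`J : Y → ℝ≥0` such that `T '' O` is measurable, `Ψ (T x) = x` for `x ∈ O`, and `((M↾(T '' O)).withDensity J).map Ψ = m↾O` — the image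
measure IS `J·M` on the image (Radon–Nikodym), and pulling it back along the measurable inverse (Lusin–Souslin) recovers `m↾O`. [folklore] -/
theorem exists_weightedInverseChart (m : Measure X) [IsFiniteMeasure m] (M : Measure Y) [SigmaFinite M]
    {T : X → Y} (hT : Measurable T) {O : Set X} (hO : MeasurableSet O) (hinj : InjOn T O)
    (hac : (m.restrict O).map T ≪ M) :
    ∃ (Ψ : Y → X) (J : Y → ℝ≥0), Measurable Ψ ∧ Measurable J ∧ MeasurableSet (T '' O) ∧
      (∀ x ∈ O, Ψ (T x) = x) ∧
      ((M.restrict (T '' O)).withDensity (fun y => (J y : ℝ≥0∞))).map Ψ = m.restrict O := by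
  -- the image is measurable (Lusin–Souslin)
  have hS : MeasurableSet (T '' O) := hO.image_of_measurable_injOn hT hinj
  -- a measurable inverse: extend the inverse of the measurable embedding `O.restrict T`
  haveI : StandardBorelSpace O := hO.standardBorel
  have hT' : Measurable (O.restrict T) := hT.comp measurable_subtype_coe
  have hinj' : Injective (O.restrict T) := (injOn_iff_injective).mp hinj
  have hemb : MeasurableEmbedding (O.restrict T) := hT'.measurableEmbedding hinj'
  obtain ⟨Ψ, hΨm, hΨ⟩ := hemb.exists_measurable_extend measurable_subtype_coe (fun _ => ‹Nonempty X›)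
  have hΨT : ∀ x ∈ O, Ψ (T x) = x := fun x hx => by
    have := congrFun hΨ ⟨x, hx⟩
    simpa only [comp_apply, restrict_apply] using this
  -- the weight: the Radon–Nikodym derivative of the image measure
  set ν : Measure Y := (m.restrict O).map T with hν
  haveI : IsFiniteMeasure ν := by rw [hν]; infer_instance
  have hνM : M.withDensity (ν.rnDeriv M) = ν := Measure.withDensity_rnDeriv_eq ν M hac
  set J : Y → ℝ≥0 := fun y => (ν.rnDeriv M y).toNNReal with hJ
  have hJm : Measurable J := (Measure.measurable_rnDeriv ν M).ennreal_toNNReal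
  have hJae : (fun y => (J y : ℝ≥0∞)) =ᵐ[M] ν.rnDeriv M := by
    filter_upwards [Measure.rnDeriv_lt_top ν M] with y hy
    exact ENNReal.coe_toNNReal hy.ne
  refine ⟨Ψ, J, hΨm, hJm, hS, hΨT, ?_⟩
  -- `(M↾S).withDensity J = (J·M)↾S = ν↾S = ν`
  have h1 : (M.restrict (T '' O)).withDensity (fun y => (J y : ℝ≥0∞)) = ν := by
    rw [← restrict_withDensity hS, withDensity_congr_ae hJae, hνM]
    exact Measure.restrict_eq_self_of_ae_mem (ae_mem_image_map_restrict m hT O hS)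
  rw [h1, hν, Measure.map_map hΨm hT]
  -- `Ψ ∘ T = id` a.e. on `m↾O`
  have h2 : (Ψ ∘ T) =ᵐ[m.restrict O] id := by
    filter_upwards [ae_restrict_mem hO] with x hx
    exact hΨT x hx
  rw [Measure.map_congr h2, Measure.map_id]

end InverseChart

/-! ## §2 (A″) One-variable absolute continuity ⇒ absolute continuity of the diagonal family, KEEPING the environment -/

section Env

variable {E G κ : Type*} [MeasurableSpace E] [MeasurableSpace G] [Fintype κ]

/-- **(A″) THE DIAGONAL FAMILY WITH ITS ENVIRONMENT IS ABSOLUTELY CONTINUOUS.**  For `ν` on `E` (s-finite), `μ` on `G` (finite), and jointly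
measurable one-variable maps `f c e : G → G` whose laws `μ.map (f c e)` are absolutely continuous for `ν`-a.e. `e` and every `c`, the law of
`(e, g) ↦ (e, (c ↦ f c e (g c)))` under `ν ⊗ μ^κ` is absolutely continuous with respect to `ν ⊗ μ^κ` (Fubini on null sets: a.e. section of a null
set is null, and the section of the preimage is the preimage under a product of absolutely continuous one-variable maps, `Measure.pi_map_pi` +
`pi_absolutelyContinuous_pi`).  Twin of `T4TriangularPushforward.map_prod_pi_absolutelyContinuous`, which forgets `e`. [folklore] -/
theorem map_prod_pi_absolutelyContinuous_env (ν : Measure E) [SFinite ν] (μ : Measure G) [IsFiniteMeasure μ]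
    (f : κ → E → G → G) (hf : ∀ c, Measurable (uncurry (f c))) (hac : ∀ᵐ e ∂ν, ∀ c, μ.map (f c e) ≪ μ) :
    (ν.prod (Measure.pi fun _ : κ => μ)).map (fun p : E × (κ → G) => (p.1, fun c => f c p.1 (p.2 c))) ≪
      ν.prod (Measure.pi fun _ : κ => μ) := by
  have hΦ : Measurable (fun p : E × (κ → G) => (p.1, fun c => f c p.1 (p.2 c))) :=
    measurable_fst.prodMk (measurable_pi_lambda _ fun c =>
      (hf c).comp (measurable_fst.prodMk ((measurable_pi_apply c).comp measurable_snd)))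
  refine Measure.AbsolutelyContinuous.mk fun s hs hs0 => ?_
  rw [Measure.map_apply hΦ hs, Measure.prod_apply (hΦ hs)]
  have hsec : (fun e => (Measure.pi fun _ : κ => μ) (Prod.mk e ⁻¹' s)) =ᵐ[ν] 0 := (Measure.measure_prod_null hs).mp hs0
  refine (lintegral_congr_ae ?_).trans lintegral_zero
  filter_upwards [hac, hsec] with e he hes
  have hfe : ∀ c, Measurable (f c e) := fun c => (hf c).comp (measurable_const.prodMk measurable_id)
  have hΦe : Measurable (fun g : κ → G => fun c => f c e (g c)) :=
    measurable_pi_lambda _ fun c => (hfe c).comp (measurable_pi_apply c)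
  show (Measure.pi fun _ : κ => μ)
      (Prod.mk e ⁻¹' ((fun p : E × (κ → G) => (p.1, fun c => f c p.1 (p.2 c))) ⁻¹' s)) = 0
  have h1 : Prod.mk e ⁻¹' ((fun p : E × (κ → G) => (p.1, fun c => f c p.1 (p.2 c))) ⁻¹' s) =
      (fun g : κ → G => fun c => f c e (g c)) ⁻¹' (Prod.mk e ⁻¹' s) := rfl
  rw [h1, ← Measure.map_apply hΦe (measurable_prodMk_left hs), Measure.pi_map_pi (fun c => (hfe c).aemeasurable)]
  exact pi_absolutelyContinuous_pi he hes

end Env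

/-! ## §3 (A) The private-coordinate weighted fibre chart of a local averaging -/

section Local

variable {ι κ G : Type*} [Fintype ι] [Fintype κ] [DecidableEq ι]
  [MeasurableSpace G] [StandardBorelSpace G] [Nonempty G]
  (μ : Measure G) [IsProbabilityMeasure μ] {β : κ → ι} {A : (ι → G) → (κ → G)}

omit [Fintype ι] [MeasurableSpace G] [StandardBorelSpace G] [Nonempty G] in
/-- In the resampled coordinates the averaging is DIAGONAL given the environment: `A (res (U′, g)) = (c ↦ A (update U′ (β c) (g c)) c)`
(`T4TriangularPushforward.apply_resample_eq`, all coordinates at once). [folklore] -/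
theorem apply_resample_eq_diag (hA : IsLocal β A) (hβ : Injective β) (U : ι → G) (g : κ → G) :
    A (extend β g U) = fun c => A (update U (β c) (g c)) c :=
  funext fun c => apply_resample_eq hA hβ U g c

omit [StandardBorelSpace G] [Nonempty G] in
/-- The law of `(U′, g) ↦ (A (res (U′, g)), U′)` under `μ^ι ⊗ μ^κ` is absolutely continuous with respect to `μ^κ ⊗ μ^ι`, as soon as every
one-variable law `μ.map (x ↦ A (update U′ (β c) x) c)` is absolutely continuous (diagonal structure + §2 + `Measure.prod_swap`). [folklore] -/
theorem map_resample_avg_absolutelyContinuous (hA : IsLocal β A) (hβ : Injective β) (hAm : Measurable A)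
    (hac : ∀ (U : ι → G) (c : κ), μ.map (fun x => A (update U (β c) x) c) ≪ μ) :
    ((Measure.pi fun _ : ι => μ).prod (Measure.pi fun _ : κ => μ)).map
        (fun p : (ι → G) × (κ → G) => (A (extend β p.2 p.1), p.1)) ≪
      (Measure.pi fun _ : κ => μ).prod (Measure.pi fun _ : ι => μ) := by
  set T'' : (ι → G) × (κ → G) → (ι → G) × (κ → G) := fun p => (p.1, fun c => A (update p.1 (β c) (p.2 c)) c) with hT''
  have hf : ∀ c : κ, Measurable (uncurry fun (U : ι → G) (x : G) => A (update U (β c) x) c) := fun c =>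
    (measurable_pi_apply c).comp (hAm.comp measurable_update')
  have hT''m : Measurable T'' :=
    measurable_fst.prodMk (measurable_pi_lambda _ fun c =>
      (hf c).comp (measurable_fst.prodMk ((measurable_pi_apply c).comp measurable_snd)))
  have heq : (fun p : (ι → G) × (κ → G) => (A (extend β p.2 p.1), p.1)) = Prod.swap ∘ T'' := by
    funext p
    simp only [hT'', comp_apply, Prod.swap_prod_mk, apply_resample_eq_diag hA hβ p.1 p.2]
  have h1 := map_prod_pi_absolutelyContinuous_env (Measure.pi fun _ : ι => μ) μ
    (fun c (U : ι → G) (x : G) => A (update U (β c) x) c) hf (ae_of_all _ fun U c => hac U c)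
  rw [heq, ← Measure.map_map measurable_swap hT''m]
  have hsw : (Measure.pi fun _ : κ => μ).prod (Measure.pi fun _ : ι => μ) =
      ((Measure.pi fun _ : ι => μ).prod (Measure.pi fun _ : κ => μ)).map Prod.swap := (Measure.prod_swap).symm
  rw [hsw]
  exact h1.map measurable_swap

/-- **(A) THE PRIVATE-COORDINATE WEIGHTED FIBRE CHART.**  `ι`, `κ` finite, `G` standard Borel with a probability measure `μ`, `β : κ → ι` injective,
`A : (ι → G) → (κ → G)` measurable and `IsLocal β A`, every one-variable law `μ.map (x ↦ A (update U (β c) x) c)` absolutely continuous, and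
`O` a measurable region of fine fields on which `A ∘ res` is injective in the private coordinates.  THEN there are measurable
`Φ : (κ → G) × (ι → G) → (ι → G)`, `J : (κ → G) × (ι → G) → ℝ≥0` and a measurable `S` such that: on `S`, `Φ` lands in the fibre over the first
coordinate and in `O`; every `res (U′, g) ∈ O` is charted (`(A (res (U′,g)), U′) ∈ S` with `Φ` returning `res (U′, g)`); and
`((((μ^κ) ⊗ (μ^ι))↾S).withDensity J).map Φ = (μ^ι)↾O` — the hypothesis `hmap` of `WeightedFibreFormula.rnTransport_ae_eq_weightedFibreIntegral_local`
with the environment `U′` as fibre parameter.  Proof: §1 applied to `T (U′, g) := (A (res (U′, g)), U′)` on `res⁻¹ O` (injective there by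
hypothesis, absolutely continuous by `map_resample_avg_absolutelyContinuous`), then `Φ := res ∘ Ψ` and `measurePreserving_resample`.
[cite: Balaban1985UV3, (13)–(18) pp.259–260] -/
theorem exists_weightedChart_of_isLocal (hA : IsLocal β A) (hβ : Injective β) (hAm : Measurable A)
    (hac : ∀ (U : ι → G) (c : κ), μ.map (fun x => A (update U (β c) x) c) ≪ μ)
    {O : Set (ι → G)} (hO : MeasurableSet O)
    (hinj : ∀ (U : ι → G) (g g' : κ → G), extend β g U ∈ O → extend β g' U ∈ O →
      A (extend β g U) = A (extend β g' U) → g = g') :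
    ∃ (Φ : (κ → G) × (ι → G) → (ι → G)) (J : (κ → G) × (ι → G) → ℝ≥0) (S : Set ((κ → G) × (ι → G))),
      Measurable Φ ∧ Measurable J ∧ MeasurableSet S ∧
      (∀ z ∈ S, A (Φ z) = z.1 ∧ Φ z ∈ O) ∧
      (∀ (U : ι → G) (g : κ → G), extend β g U ∈ O →
        (A (extend β g U), U) ∈ S ∧ Φ (A (extend β g U), U) = extend β g U) ∧
      ((((Measure.pi fun _ : κ => μ).prod (Measure.pi fun _ : ι => μ)).restrict S).withDensity
          (fun z => (J z : ℝ≥0∞))).map Φ = (Measure.pi fun _ : ι => μ).restrict O := by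
  -- the resampled space, the resampling map and the map `T`
  set m : Measure ((ι → G) × (κ → G)) := (Measure.pi fun _ : ι => μ).prod (Measure.pi fun _ : κ => μ) with hm
  set M : Measure ((κ → G) × (ι → G)) := (Measure.pi fun _ : κ => μ).prod (Measure.pi fun _ : ι => μ) with hM
  set res : (ι → G) × (κ → G) → (ι → G) := fun p => extend β p.2 p.1 with hres
  have hresm : Measurable res := measurable_resample hβ
  have hresmp : MeasurePreserving res m (Measure.pi fun _ : ι => μ) := measurePreserving_resample μ hβ
  set T : (ι → G) × (κ → G) → (κ → G) × (ι → G) := fun p => (A (res p), p.1) with hT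
  have hTm : Measurable T := (hAm.comp hresm).prodMk measurable_fst
  have hÕ : MeasurableSet (res ⁻¹' O) := hresm hO
  -- injectivity on `res⁻¹ O`
  have hinjT : InjOn T (res ⁻¹' O) := by
    rintro ⟨U, g⟩ hp ⟨U', g'⟩ hq hpq
    simp only [hT, Prod.mk.injEq] at hpq
    obtain ⟨hA', rfl⟩ := hpq
    simp only [mem_preimage, hres] at hp hq
    rw [hinj U g g' hp hq hA']
  -- absolute continuity of the restricted push-forward
  have hacT : (m.restrict (res ⁻¹' O)).map T ≪ M :=
    (Measure.absolutelyContinuous_of_le (Measure.map_mono Measure.restrict_le_self hTm)).trans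
      (map_resample_avg_absolutelyContinuous μ hA hβ hAm hac)
  haveI : IsFiniteMeasure m := by rw [hm]; infer_instance
  haveI : SigmaFinite M := by rw [hM]; infer_instance
  obtain ⟨Ψ, J, hΨm, hJm, hS, hΨT, hmap⟩ := exists_weightedInverseChart m M hTm hÕ hinjT hacT
  refine ⟨res ∘ Ψ, J, T '' (res ⁻¹' O), hresm.comp hΨm, hJm, hS, ?_, ?_, ?_⟩
  · rintro z ⟨p, hp, rfl⟩
    refine ⟨?_, ?_⟩
    · show A (res (Ψ (T p))) = A (res p)
      rw [hΨT p hp]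
    · show res (Ψ (T p)) ∈ O
      rw [hΨT p hp]; exact hp
  · intro U g hUg
    have hp : ((U, g) : (ι → G) × (κ → G)) ∈ res ⁻¹' O := hUg
    refine ⟨⟨(U, g), hp, rfl⟩, ?_⟩
    show res (Ψ (T (U, g))) = res (U, g)
    rw [hΨT (U, g) hp]
  · rw [← Measure.map_map hresm hΨm, hmap, ← Measure.restrict_map hresm hO, hresmp.map_eq]

end Local

end Summit.QuantumFields.YangMills.Theorems.WeightedInverseChart

end
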